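import Summits.Ventures.HSemireg.DerivedDescentTriangle
import Summits.Ventures.HSemireg.HomComplexShortExact
import Summits.Ventures.HSemireg.HomComplexSupertrace
import Literature.AlgebraicGeometry.Modules.SheafHomFrames
import HarnessLib

/-!
# Trace linearity on complex carriers: the supertrace intertwines `Φ_K(δ_{K ⊗ G•})` with `δ_{G•}`

Let `X` be a scheme with a derived category of `𝒪_X`-modules, `K•` a cochain complex with finite locally free terms
such that `𝓗om•(K•, –) ⋙ Q` inverts quasi-isomorphisms (`hΦ`; e.g. `K•` strictly perfect,
`HomComplex.homFunctor_isInvertedBy`), and `T : 0 → G₁ → G₂ → G₃ → 0` a short exact sequence of `𝒪_X`-MODULES.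
Tensoring termwise gives a short exact sequence of complexes `K ⊗ T : 0 → K ⊗ G₁ → K ⊗ G₂ → K ⊗ G₃ → 0`
(`twistShortComplex`, `twistShortComplex_shortExact`; `K ⊗ G = HomComplex.twistG X G K`), whence a connecting
morphism `ν_T(K) := δ_{K ⊗ T} : Q(K ⊗ G₃) ⟶ Q(K ⊗ G₁)⟦1⟧` — «multiplication by the class of `T` on `K`».
We prove (`shiftedHomMap_twistδ_comp_supertrace`):

  `Φ_K(ν_T(K)) ≫ Q(Tr•_{G₁})⟦1⟧ = Q(Tr•_{G₃}) ≫ δ_{T[0]}`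

where `Φ_K = DerivedDescent.shiftedHomMap (homFunctor X K)` is the map through which the tree DEFINES `σ_q` of a complex
(`HomComplexSigma.lean`), `Tr•` is p3's supertrace (`HomComplexSupertrace.lean`) and `δ_{T[0]}` the connecting morphism
of the single complexes of `T`.  Ingredients: `BifunctorCone.shiftedHomMap_triangleOfSESδ` (the descended `𝓗om•(K•, –)`
maps `δ` to `δ`, `DerivedDescentTriangle.lean`), `homFunctor_map_shortExact` (`HomComplexShortExact.lean`), the
naturality of the supertrace in the coefficients (`HomComplex.supertrace_naturality`) and of `triangleOfSESδ` (Mathlib).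

HONEST FRAMING (cell pub-hsemireg, seat gs-g4; brick C2a of general-structure/COMPLEX-LEIBNIZ-PLAN-gs-g4.md): this is
the complex-carrier «trace linearity» input of the Leibniz re-expansion `hσ` — the mixing maps of the triangular argument
are the `(– ≫ δ_{T[0]})`; nothing here says HC, HC_CM or HC_AV is proved.

## References
* R.-O. Buchweitz, H. Flenner, *A semiregularity map for modules and applications to deformations*, Compositio Math.
  137 (2003), §4 (trace maps and their linearity). [BuchweitzFlenner2003]
-/

noncomputable section

set_option backward.isDefEq.respectTransparency false

open CategoryTheory CategoryTheory.Category CategoryTheory.Limits AlgebraicGeometry DerivedCategory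

namespace Summit.Ventures.HSemireg

namespace HomComplex

open Literature.AlgebraicGeometry.Modules Literature.AlgebraicGeometry.Motives

universe w u

variable (X : Scheme.{u}) (T : ShortComplex X.Modules) (K : CochainComplex X.Modules ℤ)
  (hK : ∀ p, IsFiniteLocallyFree (K.X p))

/-- `K ⊗ T`: a short complex of modules tensored termwise with a complex (`twistG`, `twistGMap`). [folklore] -/
def twistShortComplex : ShortComplex (CochainComplex X.Modules ℤ) :=
  ShortComplex.mk (twistGMap X K T.f) (twistGMap X K T.g) (by
    refine HomologicalComplex.hom_ext _ _ fun n => ?_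
    rw [HomologicalComplex.comp_f, HomologicalComplex.zero_f, NatTrans.mapHomologicalComplex_app_f,
      NatTrans.mapHomologicalComplex_app_f, twistCoeffNatTrans_app, twistCoeffNatTrans_app, ← sheafHomMap_comp, T.zero,
      ← sheafHomFunctor_map, Functor.map_zero])

include hK in
/-- `K ⊗ T` is short exact when `T` is and the terms of `K` are finite locally free (`𝓗om((Kᵖ)^∨, –)` is exact).
[cite: Hartshorne1977, II Ex. 5.1 (b)] -/
theorem twistShortComplex_shortExact (hT : T.ShortExact) : (twistShortComplex X T K).ShortExact := by
  refine HomologicalComplex.shortExact_of_degreewise_shortExact _ fun n => ?_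
  haveI := preservesFiniteColimits_sheafHomFunctor (dual (K.X n)) (isFiniteLocallyFree_dual (hK n))
  exact ShortComplex.shortExact_of_iso (ShortComplex.isoMk (Iso.refl _) (Iso.refl _) (Iso.refl _)
    (by simp [twistShortComplex]) (by simp [twistShortComplex])) (hT.map_of_exact (sheafHomFunctor (dual (K.X n))))

/-- The supertraces form a morphism of short complexes `𝓗om•(K, K ⊗ T) ⟶ T[0]` (naturality of `Tr•` in the
coefficients). [cite: BuchweitzFlenner2003, §4] -/
def supertraceShortComplexHom :
    (twistShortComplex X T K).map (homFunctor X K) ⟶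
      T.map (HomologicalComplex.single X.Modules (ComplexShape.up ℤ) 0) where
  τ₁ := supertrace X T.X₁ K hK
  τ₂ := supertrace X T.X₂ K hK
  τ₃ := supertrace X T.X₃ K hK
  comm₁₂ := (supertrace_naturality X K hK T.f).symm
  comm₂₃ := (supertrace_naturality X K hK T.g).symm

variable [HasDerivedCategory.{w} X.Modules]
  (hΦ : (HomologicalComplex.quasiIso X.Modules (ComplexShape.up ℤ)).IsInvertedBy (homFunctor X K ⋙ DerivedCategory.Q))

include hK in
/-- **Trace linearity on complex carriers.** For a short exact sequence of modules `T` and a complex `K` with finite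
locally free terms, the descended internal Hom functor `Φ_K` sends the connecting morphism `ν_T(K) = δ_{K ⊗ T}` to a
map intertwined by the supertraces with the connecting morphism of `T[0]`:
`Φ_K(δ_{K ⊗ T}) ≫ Q(Tr•_{G₁})⟦1⟧ = Q(Tr•_{G₃}) ≫ δ_{T[0]}`. [cite: BuchweitzFlenner2003, §4] -/
theorem shiftedHomMap_twistδ_comp_supertrace (hT : T.ShortExact) :
    shiftedHomMap (homFunctor X K) hΦ
        (triangleOfSESδ (twistShortComplex_shortExact X T K hK hT) :
          ShiftedHom (DerivedCategory.Q.obj (twistG X T.X₃ K)) (DerivedCategory.Q.obj (twistG X T.X₁ K)) (1 : ℤ)) ≫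
      (DerivedCategory.Q.map (supertrace X T.X₁ K hK))⟦(1 : ℤ)⟧' =
    DerivedCategory.Q.map (supertrace X T.X₃ K hK) ≫
      triangleOfSESδ (hT.map_of_exact (HomologicalComplex.single X.Modules (ComplexShape.up ℤ) 0)) := by
  rw [BifunctorCone.shiftedHomMap_triangleOfSESδ (sheafHomBifunctor X).flip (dualComplex X K) hΦ
    (twistShortComplex_shortExact X T K hK hT) (homFunctor_map_shortExact K hK (twistShortComplex_shortExact X T K hK hT))]
  exact triangleOfSESδ_naturality _ _ (supertraceShortComplexHom X T K hK)

end HomComplex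

end Summit.Ventures.HSemireg

end
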